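import Summits.BirchSwinnertonDyer.Rank1Residual.Partition.MainConjecturesIrreducibleBDP
import HarnessLib

/-!
# Rows C2 (`r ≤ 1`) and C3-ordinary (`p ≥ 5`) of the partition from NAMED LITERATURE FACTS:
# cyclotomic IMC (BCS 2025 Thm. 1.1.2 (b)) + anticyclotomic IMC ∘ BDP (BCS 2025 Thm. 1.2.4 (b) ∘
# CGLS 2022 Thm. 5.1.3) + anticyclotomic control (CGLS 2022 Thm. 5.1.1 / JSW 2017 Thm. 3.3.1) ⇒ `BSD(E,p)`

HONEST FRAMING (cell `b2b-bsdres`, run/shared/lean/b2b/bsd-rank1-residual/; page 1 of every file):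
the goal is to DELETE the COMBINATION-SHAPED residual classes — to produce a Lean theorem "BSD_p
formula for every rank `≤ 1` curve in class `C`" assembled STRICTLY from published theorems — so
that the remainder becomes exactly the CONSTRUCTION-SHAPED classes, which are TYPED, not attempted;
this is not "finishing BSD". Every published theorem enters as one of the tree's existing named
Literature facts `(h : <Fact>)` (a `def … : Prop` vendored with its cite, D-0014; nothing asserted, no
new fact, no `sorry`). Unit `b2b-bsdres-lit-glue` (GLUE seat), gen 6, File G (class half; the
adapters are in `Partition/MainConjecturesIrreducibleBDP.lean`).

## Contents (the `hLA` binder of gens 3–6 DISCHARGED)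

* `RowC2.bsdp_of_bcsThm112b_of_thm511_of_thm124b` — row C2, `r ≤ 1`, OFF the anomalous line
  (`a_p ≢ 1 (mod p)`): gen 5's `RowC2.bsdp_of_bcsThm112b_of_thm511` fed by the BCS ∘ BDP fact; inputs =
  named facts + `hna` + `p ∤ ∏c_ℓ` in rank one.
* `RowC2.bsdp_of_bcsThm112b_of_thm331_of_thm124b` — row C2, `r ≤ 1`, EVERY pair: gen 6 File C's
  `RowC2.bsdp_of_bcsThm112b_of_thm331` fed through the σ-bridge; inputs = named facts + (irr_K) at the
  Heegner fields in rank one + `p ∤ ∏c_ℓ` in rank one.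
* `RowC3.bsdp_of_thm331_of_thm124b_of_columnMainConjectures` — row C3 (JSW 2017 Thm. 1.2.1's class):
  ordinary `p ≥ 5` from named facts + (irr_K) + `p ∤ ∏c_ℓ`; ordinary `p = 3` keeps the typed
  (IMC≥∘BDP)ᵍ (`hLA3`: Yan–Zhu 2026 Thm. 4.12 is not yet a composite Literature fact); supersingular:
  the typed Kobayashi signed MC (OPEN in print) + BKO 2024 Cor. A.5, as in gens 4–6.

For row C2 this is the printed proof of Burungale–Castella–Skinner 2025 Cor. 1.3.1 (p. 4: "the result
in the case `r = 0` follows from Theorem 1.2.2 [sic: 1.1.2] and [Gre99, Thm. 4.1] … in the case `r = 1`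
from Theorem 1.2.4, the `p`-adic Waldspurger formula [BDP13], the anticyclotomic control theorem
[JSW17, Thm. 3.3.1], and the `r = 0` result for the `K`-quadratic twist of `E`"), kernel-checked at
statement level with every input a named, cited Literature fact; explicit residual binders: (irr_K)
(resp. `hna`), `p ∤ ∏c_ℓ` in rank one (gen 3's STEP-L restriction), nothing else. Registry flags
inherited, not decided here: `BCS25-IMC-equiv@BSTW` on every use of BCS 2025 (T-BCS / A148);
`BCS-124-XGr-reading` offered with the fact.

References: [BurungaleCastellaSkinner2025] Thm. 1.1.2 (b), Thm. 1.2.4 (b), Cor. 1.3.1 (proof p. 4);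
[CastellaGrossiLeeSkinner2022] Thm. 5.1.1, 5.1.3; [JetchevSkinnerWan2017] Thm. 1.2.1, 3.3.1, §7.4.1;
[YanZhu2024MainConjNonCM] Thm. 4.9, 4.12; [BurungaleKobayashiOta2023] App. A Cor. A.5;
HOME/b2b-bsdres-lit-glue/GLUE.md GEN 6 ADDENDUM.
-/

set_option autoImplicit false

noncomputable section

open scoped Classical

open WeierstrassCurve NumberField IsDedekindDomain Literature.NumberTheory.EllipticCurves
  Literature.NumberTheory.EllipticCurves.ModularForms Literature.NumberTheory.Automorphic
  Literature.NumberTheory.EllipticCurves.Rank1Residual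
  Literature.NumberTheory.EllipticCurves.YanZhu2026
  Literature.NumberTheory.EllipticCurves.BurungaleCastellaSkinner2025
  Literature.NumberTheory.EllipticCurves.BurungaleKobayashiOta2024
  Literature.NumberTheory.EllipticCurves.CastellaGrossiLeeSkinner2022
  Literature.NumberTheory.EllipticCurves.JetchevSkinnerWan2017
  Summit.BirchSwinnertonDyer.BirchSwinnertonDyer.Theorems.Rank1ResidualX1Defs

namespace Summit.BirchSwinnertonDyer.Rank1Residual

/-! ### §5 Rows C2 and C3 with BOTH anticyclotomic links published -/

section Rows

variable (W : WeierstrassCurve ℚ) [W.IsElliptic] [W.IsGloballyMinimal] (p : ℕ) [Fact p.Prime]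

/-- **Row C2 (`r ≤ 1`) off the anomalous line from NAMED LITERATURE FACTS** (+ `hna`, + `p ∤ ∏c_ℓ` in
rank one): gen 5's `RowC2.bsdp_of_bcsThm112b_of_thm511` with its last typed binder `hLA` DISCHARGED by
BCS 2025 Thm. 1.2.4 (b) ∘ CGLS 2022 Thm. 5.1.3 (`h124`, §4). Inputs: BCS Thm. 1.1.2 (b) (`hBCS`,
cyclotomic IMC), CGLS Thm. 5.1.1 (`h511`, control), `h124` (anticyclotomic IMC ∘ BDP), Gross–Zagier,
Kolyvagin, GZK, Greenberg 4.1, modularity, Hoffstein–Luo / BFH, Mazur (Manin), Néron scaling — all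
named facts of the tree. This is the printed proof of BCS Cor. 1.3.1 (p. 4: "Theorem 1.2.4, the
`p`-adic Waldspurger formula, the anticyclotomic control theorem, and the `r = 0` result for the
`K`-quadratic twist"), kernel-checked at statement level, off the anomalous line.
[cite: BurungaleCastellaSkinner2025, Thm. 1.1.2 (b), Thm. 1.2.4 (b), Cor. 1.3.1 and its proof (p. 4)]
[cite: CastellaGrossiLeeSkinner2022, Thm. 5.1.1, Thm. 5.1.3] [cite: Miller2011LMS, Def. 1.1] -/
theorem RowC2.bsdp_of_bcsThm112b_of_thm511_of_thm124b
    (hGZ : ∀ (N : ℕ) [NeZero N] (W : WeierstrassCurve ℚ) (K : Type) [Field K] [NumberField K],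
      gross_zagier N W K)
    (hKo : ∀ (N : ℕ) [NeZero N] (W : WeierstrassCurve ℚ) (K : Type) [Field K] [NumberField K],
      kolyvagin N W K)
    (hB : ∀ (N : ℕ) [NeZero N] (W : WeierstrassCurve ℚ) (K : Type) [Field K] [NumberField K],
      Kolyvagin1990_padicValNat_card_sha_le N W K)
    (hBCS : thm112b_charIdeal_eq_padicLFunction_integral) (h511 : thm511_anticyclotomicControl)
    (h124 : thm124b_thm513_generator_constantCoeff)
    (hGr : greenberg_charValue_rankZero) (hGZK : rank_eq_analyticRank_of_analyticRank_le_one)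
    (hmod : hasEntireLFunction_rat) (hpar : nonempty_modularParametrizationData)
    (hnf : exists_isNewformOf) (hHL : HoffsteinLuo1997_exists_twist_L_one_ne_zero)
    (hMaz : mazur_not_dvd_maninConstant_of_odd) (hNS : integral_neronScaling_of_isGloballyMinimal)
    (h : RowC2 W p) (hr : W.analyticRank ≤ 1) (hna : ¬ (p : ℤ) ∣ W.frobeniusTrace p - 1)
    (htam0 : W.analyticRank = 1 → ¬ p ∣ W.tamagawaProduct) :
    BSDp W p := by
  refine RowC2.bsdp_of_bcsThm112b_of_thm511 W p hGZ hKo hB hBCS h511 hGr hGZK hmod hpar hnf hHL hMaz hNS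
    h hr hna htam0 ?_
  intro N _ K _ _ Dt H ιC P hN hK hodd hlt hHN hHp _ hP hc hPinf κ hκ γ _ ι vbar hvbar hne
  exact X11b.imcLowerWaldspurgerOnTreeGoodAt_of_heegner_of_thm124b_of_thm511 W p N K Dt H ιC P h124
    h511 (hKo N W K) h.2.1 h.2.2.1 (surj_of_irr_of_bigIm W p h.2.2.2.1 h.2.2.2.2) hna hN hK hodd hlt hHN
    hHp hP hc hPinf hκ ι vbar hvbar hne

/-- **Row C2 (`r ≤ 1`) at EVERY pair of the row (anomalous included) from NAMED LITERATURE FACTS** (+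
(irr_K) at the Heegner fields in rank one, + `p ∤ ∏c_ℓ` in rank one): gen 6 File C's
`RowC2.bsdp_of_bcsThm112b_of_thm331` (control = JSW 3.3.1, no `hna`) with its last typed binder `hLA`
(JSW letter) DISCHARGED by BCS 1.2.4 (b) ∘ CGLS 5.1.3 through the σ-bridge (§3–§4). (irr_K) ⇐ (sur)
for `p` split in `K` in print (BCS p. 4 via [JSW17]); not a tree theorem (no bridge between
`geomTorsion W p` and `geomTorsion (W.baseChange K) p` yet) — carried as `hIrrK`.
[cite: BurungaleCastellaSkinner2025, Thm. 1.1.2 (b), Thm. 1.2.4 (b), Cor. 1.3.1 and its proof (p. 4)]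
[cite: JetchevSkinnerWan2017, Thm. 3.3.1] [cite: CastellaGrossiLeeSkinner2022, Thm. 5.1.3] -/
theorem RowC2.bsdp_of_bcsThm112b_of_thm331_of_thm124b
    (hGZ : ∀ (N : ℕ) [NeZero N] (W : WeierstrassCurve ℚ) (K : Type) [Field K] [NumberField K],
      gross_zagier N W K)
    (hKo : ∀ (N : ℕ) [NeZero N] (W : WeierstrassCurve ℚ) (K : Type) [Field K] [NumberField K],
      kolyvagin N W K)
    (hB : ∀ (N : ℕ) [NeZero N] (W : WeierstrassCurve ℚ) (K : Type) [Field K] [NumberField K],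
      Kolyvagin1990_padicValNat_card_sha_le N W K)
    (hBCS : thm112b_charIdeal_eq_padicLFunction_integral) (h331 : thm331_anticyclotomicControl)
    (h124 : thm124b_thm513_generator_constantCoeff)
    (hGr : greenberg_charValue_rankZero) (hGZK : rank_eq_analyticRank_of_analyticRank_le_one)
    (hmod : hasEntireLFunction_rat) (hpar : nonempty_modularParametrizationData)
    (hnf : exists_isNewformOf) (hHL : HoffsteinLuo1997_exists_twist_L_one_ne_zero)
    (hMaz : mazur_not_dvd_maninConstant_of_odd) (hNS : integral_neronScaling_of_isGloballyMinimal)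
    (h : RowC2 W p) (hr : W.analyticRank ≤ 1)
    (htam0 : W.analyticRank = 1 → ¬ p ∣ W.tamagawaProduct)
    (hIrrK : W.analyticRank = 1 → ∀ (K : Type) [Field K] [NumberField K], IsImaginaryQuadratic K →
      SatisfiesHeegnerHypothesis (W.conductorNorm ℤ) K → SatisfiesHeegnerHypothesis p K →
      (W.baseChange K).HasIrreducibleModPGaloisRep p) :
    BSDp W p := by
  refine RowC2.bsdp_of_bcsThm112b_of_thm331 hGZ hKo hB hBCS h331 hGr hGZK hmod hpar hnf hHL hMaz hNS
    h hr htam0 hIrrK ?_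
  intro hr1 N _ K _ _ Dt H ιC P hN hK hodd hlt hHN hHp _ hP hc hPinf κ hκ γ _ ι
  have hHN' : SatisfiesHeegnerHypothesis (W.conductorNorm ℤ) K := by rw [hN]; exact hHN
  exact X11b.imcLowerWaldspurgerOnTreeGoodAt_inducedPlace_of_heegner_of_thm124b_of_thm331 W p N K Dt H
    ιC P h124 h331 (hKo N W K) h.2.1 h.2.2.1 (surj_of_irr_of_bigIm W p h.2.2.2.1 h.2.2.2.2)
    (hIrrK hr1 K hK hHN' hHp) hN hK hodd hlt hHN hHp hP hc hPinf hκ ι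

/-- **Row C3 at every prime of the row, the ORDINARY `p ≥ 5` branch from NAMED LITERATURE FACTS** (+
(irr_K), + `p ∤ ∏c_ℓ`): gen 6 File C's `RowC3.bsdp_of_thm331_of_columnMainConjectures` with `hLA`
DISCHARGED on the branch `p ≥ 5` ordinary by BCS 1.2.4 (b) ∘ CGLS 5.1.3 (`p > 3`, (sur) from
Diamond's refined Serre `RowC3.surj`); at ordinary `p = 3` the row's anticyclotomic IMC in print is
Yan–Zhu 2026 Thm. 4.12 (not yet a composite Literature fact) — kept typed as `hLA3`; supersingular:
typed Kobayashi MC + BKO Cor. A.5, as before.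
[cite: JetchevSkinnerWan2017, Thm. 1.2.1, Thm. 3.3.1] [cite: BurungaleCastellaSkinner2025, Thm. 1.1.2 (b), Thm. 1.2.4 (b)]
[cite: YanZhu2024MainConjNonCM, Thm. 4.9, Thm. 4.12] [cite: BurungaleKobayashiOta2023, App. A Cor. A.5] -/
theorem RowC3.bsdp_of_thm331_of_thm124b_of_columnMainConjectures
    (hGZ : ∀ (N : ℕ) [NeZero N] (W : WeierstrassCurve ℚ) (K : Type) [Field K] [NumberField K],
      gross_zagier N W K)
    (hKo : ∀ (N : ℕ) [NeZero N] (W : WeierstrassCurve ℚ) (K : Type) [Field K] [NumberField K],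
      kolyvagin N W K)
    (hB : ∀ (N : ℕ) [NeZero N] (W : WeierstrassCurve ℚ) (K : Type) [Field K] [NumberField K],
      Kolyvagin1990_padicValNat_card_sha_le N W K)
    (hBCS : thm112b_charIdeal_eq_padicLFunction_integral)
    (hYZ : thm49_charIdeal_eq_padicLFunction_integral)
    (hW20 : Wuthrich2014.lemma20_surjective_threeAdic_of_semistable)
    (h331 : thm331_anticyclotomicControl) (h124 : thm124b_thm513_generator_constantCoeff)
    (hA5 : corA5_pPart_of_signedCharIdeal_eq)
    (hGr : greenberg_charValue_rankZero) (hGZK : rank_eq_analyticRank_of_analyticRank_le_one)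
    (hmod : hasEntireLFunction_rat) (hpar : nonempty_modularParametrizationData)
    (hnf : exists_isNewformOf) (hLL : diamond1995_refinedSerre)
    (hHL : HoffsteinLuo1997_exists_twist_L_one_ne_zero)
    (hMaz : mazur_not_dvd_maninConstant_of_odd) (hNS : integral_neronScaling_of_isGloballyMinimal)
    (h : RowC3 W p)
    (htam0 : GoodOrd W p → ¬ p ∣ W.tamagawaProduct)
    (ε : ℤˣ) (hKMC : (p : ℤ) ∣ W.frobeniusTrace p → Supersingular.KobayashiMainConjecture W p ε)
    (hIrrK : GoodOrd W p → ∀ (K : Type) [Field K] [NumberField K], IsImaginaryQuadratic K →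
      SatisfiesHeegnerHypothesis (W.conductorNorm ℤ) K → SatisfiesHeegnerHypothesis p K →
      (W.baseChange K).HasIrreducibleModPGaloisRep p)
    (hLA3 : p = 3 → GoodOrd W p → ∀ (N : ℕ) [NeZero N] (K : Type) [Field K] [NumberField K]
      (Dt : ModularParametrizationData W N) (H : HeegnerDatum N (NumberField.discr K)) (ιC : K →+* ℂ)
      (P : (W.baseChange K).toAffine.Point),
      W.conductorNorm ℤ = N → IsImaginaryQuadratic K → Odd (NumberField.discr K) →
      NumberField.discr K < -4 → SatisfiesHeegnerHypothesis N K → SatisfiesHeegnerHypothesis p K →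
      (W.quadraticTwist (NumberField.discr K : ℚ)).entireLFunction 1 ≠ 0 →
      WeierstrassCurve.Affine.Point.map ιC.toRatAlgHom P = heegnerPointComplex Dt H →
      ¬ (p : ℤ) ∣ Dt.c → ¬ IsOfFinAddOrder P →
      ∀ (κ : ZpExtension K p), κ.IsAnticyclotomic →
        ∀ (γ : Field.absoluteGaloisGroup K) [Fact (κ.IsTopGenerator γ)] (ι : K →+* ℚ_[p]),
          X11b.IMCLowerWaldspurgerOnTreeGoodAt p κ (X11b.inducedPlace ι) γ ι P) :
    BSDp W p := by
  refine RowC3.bsdp_of_thm331_of_columnMainConjectures hGZ hKo hB hBCS hYZ hW20 h331 hA5 hGr hGZK hmod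
    hpar hnf hLL hHL hMaz hNS h htam0 ε hKMC hIrrK ?_
  intro hord N _ K _ _ Dt H ιC P hN hK hodd hlt hHN hHp hLt hP hc hPinf κ hκ γ _ ι
  by_cases h5 : 3 < p
  · have hHN' : SatisfiesHeegnerHypothesis (W.conductorNorm ℤ) K := by rw [hN]; exact hHN
    exact X11b.imcLowerWaldspurgerOnTreeGoodAt_inducedPlace_of_heegner_of_thm124b_of_thm331 W p N K Dt
      H ιC P h124 h331 (hKo N W K) h5 hord (RowC3.surj hnf hLL h) (hIrrK hord K hK hHN' hHp) hN hK hodd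
      hlt hHN hHp hP hc hPinf hκ ι
  · have h3 : p = 3 := by rcases h.2.2.2.2 with h5' | ⟨h3, -⟩ <;> omega
    exact hLA3 h3 hord N K Dt H ιC P hN hK hodd hlt hHN hHp hLt hP hc hPinf κ hκ γ ι

end Rows

end Summit.BirchSwinnertonDyer.Rank1Residual

end
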